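import Summits.CriticalPhenomena.CardyFormulaZ2.Theses.DyadicBetaRigidity
import Summits.CriticalPhenomena.CardyFormulaZ2.Theses.CardyExpCovariance
import Summits.CriticalPhenomena.CardyFormulaZ2.Theorems.DyadicBetaRigidityDyadicLatticeBetaLawStubSubseqSandwich
import Summits.CriticalPhenomena.CardyFormulaZ2.Theorems.DyadicBetaRigidityDyadicLatticeBetaLawStubRectSubseqLimits
import Summits.CriticalPhenomena.CardyFormulaZ2.Theorems.DyadicBetaRigidityDyadicLatticeBetaLawStubClusterLaw
import Summits.CriticalPhenomena.CardyFormulaZ2.Theorems.DyadicBetaRigidityDyadicLatticeBetaLawStubS1OfCrux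
import Literature.Probability.RandomPlanarGeometry.CardyFunctionIncBeta
import Literature.Probability.RandomPlanarGeometry.ConformalRectangleProofs

/-!
# Line `Sketch` (idea `equimodular-comparison`) — lead skeleton for crux `DyadicLatticeBetaLaw`
# (stmt-CriticalPhenomena-18183, route `DyadicBetaRigidity` of `CardyFormulaZ2`)

    DyadicLatticeBetaLaw := ∃ a ∈ (0,1), ∀ h > 0, ∀ lattice polygon R of hℤ², ∀ (φ, x) uniformizing,
        P_{1/2}[R crossed at mesh h/2^k] ⟶ I_a(crossRatio x)   (k → ∞).

THE LINE (crux-ideate r1 k2, card `Ideas/equimodular-comparison.md`, composition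
`crux_of_cluster_rigidity : DyadicClusterConformal → CardyRigiditySeq → DyadicLatticeBetaLaw` of the
k2 sketch, reshaped by the lead into registered stubs).  EXISTENCE of the dyadic limit is never
proved inside this crux: a cluster point `p` of the bounded sequence `k ↦ P[R, h/2^k]` along a
subsequence `κ` is turned, by a purely COMPARATIVE hypothesis on bond-`ℤ²` (stub S1) plus proved
bookkeeping (stubs S5a, S5b, S2), into the value `f(η_R)` of a crossing-limit system of ALL conformal
rectangles along the meshes `1/2^(κ (σ n))`; the shared sequential rigidity item `CardyRigiditySeq`
(stmt-CriticalPhenomena-4680, route CardyExpCovariance; stub S3 verbatim) forces `f = cardyFunction`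
on `(0,1)`, so every cluster point is `F(η_R) = I_{2/3}(η_R)` and the whole dyadic sequence converges
(`tendsto_of_subseq_tendsto`).  `a := 2/3` via the tree identity `cardyFunction_eq_incBeta13_div_holds`.

Stubs (device D-0027 §3.3: `protected theorem Holds.stub_<name> : <statement> := by sorry` + handle
`def stub_<name> : Prop := type_of% Holds.stub_<name>`):

* S1 `stub_equicontinuousComparison` — HARD (lead): equimodular lattice polygons are asymptotically
  indistinguishable along the dyadic ladders, equicontinuously in the modulus (EQ of the card + the
  RSW modulus-equicontinuity the card lists as bookkeeping; implied by `CardyFormulaZ2`, implies EQ).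
* S2 `stub_subseqSandwich` — the two one-sided Bollobás–Riordan bounds for EVERY conformal rectangle
  along `1/2^(κ n)`, from convergence of all lattice polygons along the shifted ladders
  `h 2^j / 2^(κ n)` to a law `f` continuous on `(0,1)` (sequential form of the LANDED glue
  `DyadicLattice.hasCrossingLimit_of_dyadicLattice`, Theorems/DyadicBetaRigidityDyadicBetaSuffices.lean;
  no symmetry of `f` assumed: the upper bound reads `1 - f (1 - η)`).
* S3 `stub_cardyRigiditySeq` — VERBATIM the item `CardyExpCovariance.CardyRigiditySeq` (stmt-4680,
  `stub_cardyRigiditySeq_iff`); closes when that item closes; not worked here.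
* S5a `stub_rectSubseqLimits` — pure percolation: along a sub-subsequence, the corner-marked boxes
  `(0,w) × (0,1)` (left–right family `Q`, bottom–top family `Q'`) converge at the meshes `1/2^(κ (σ n))`
  for EVERY real `w > 0`, to `g`, `g'` continuous with `g + g' = 1` (diagonal extraction over
  rational widths, the landed mesh-uniform equicontinuity `crossingProb_uniformIncrement`, the exact
  box identification `RectangleDuality.bond_lr_eq` / `bond_bt_le` / `le_bond_bt` and exact duality
  `crossingProb_add_crossingProb_symm_holds`).
* S5b `stub_clusterLawOfComparison` — bookkeeping: S1 + S5a ⇒ through every cluster point `p` of a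
  lattice polygon's dyadic sequence passes a law `f`, continuous and self-dual on `(0,1)`, to which
  EVERY lattice polygon converges along the shifted ladders of a common sub-subsequence (`f := g ∘ η⁻¹`
  via the landed rectangle families `stub_rectangleFamily` and `rectangle_crossRatio_eq_of_aspectRatio_holds`;
  transfer and symmetry by S1; `f(η_R) = p` by uniqueness of limits).

Composition `DyadicLatticeBetaLaw_of : S1 → S2 → S5a → S5b → S3 → DyadicLatticeBetaLaw` is PROVED
below (no `sorry` outside `stub_*`).

STATUS (lead cycle 1, 2026-08-17): S2 LANDED p166738, S5a LANDED p168483 (+p167690), S5b LANDED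
p169175 (+p169117) — their `Holds.stub_*` bodies below are now the landed theorems; OPEN: S1 (hard,
lead) and S3 (= item stmt-CriticalPhenomena-4680).  The crux is kernel-reduced to
`stub_equicontinuousComparison ∧ CardyRigiditySeq` (`DyadicLatticeBetaLaw_of_S1_of_rigiditySeq`), and
conversely the crux implies S1 (`Stubs.stub_equicontinuousComparison_of_crux`, p169502), so modulo
stmt-4680 the crux ⟺ S1 (`dyadicLatticeBetaLaw_iff_S1`).

## Disproof used
`Cruxes/DyadicLatticeBetaLaw/Disproof.lean` (refuter-rattack-…-18183-0, 2026-08-17T05:04Z): no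
`_false_without_<H>`, no `-- Targets`, no `Negative/` lemma.  Honoured: `dyadicLatticeBetaLaw_of_cardyFormulaZ2`
(S → C, `a = 2/3`) — this composition also outputs `a = 2/3`, and S1 is itself a consequence of S
(continuity of Cardy's `F`), so S1 is not refutable short of `¬ CardyFormulaZ2`; `dyadicLatticeBetaLaw_nonvacuous`
— S1's hypothesis class (pairs of near-equimodular lattice polygons) is inhabited non-trivially
(R vs R at mesh h/2, R vs its D₄ images, boxes of all widths); `tendsto_unitSquare_of_dyadicLatticeBetaLaw`
— reproduced (unit square is a box of the family `Q`).  Negatives: NegDegenerateArcs (stmt-0748) respected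
(all values `f(η)`, `η ∈ (0,1)`); ScaleCovarianceNotMoebius / stmt-0698 not engaged (no similarity ⇒ Möbius
upgrade; the only upgrade, uniqueness ⇒ existence, is the theorem below).

## Barriers (`Literature/Barriers/CriticalPhenomena/`)
`EmbeddingModulusUniqueness` — respected, not evaded by blindness: S1 is false for the sheared lattice
(equal true moduli, different limits), so any proof of S1 must use the square embedding; S2/S5 use the
exact dilation covariance and the D₄/duality symmetry of `ℤ²`.  `SmirnovTriangularOnly`,
`CoveringLatticeShift`, `FKParafermionicHalfCauchyRiemann`, `QuarterTurnResistorLaw`,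
`RigorousRGSmallParameterNarrow` — not engaged (no observable, no lattice rewriting, no corner scheme,
no RG).
-/

noncomputable section

open MeasureTheory Filter Set Topology
open UpperHalfPlane (upperHalfPlaneSet)
open Literature.Probability.RandomPlanarGeometry Literature.Probability.LatticeModels
open Literature.Probability.Percolation hiding cardyFunction

namespace Summit.CriticalPhenomena.CardyFormulaZ2.Cruxes.DyadicLatticeBetaLaw.EquimodularComparison

/-- STUB S1 — **equicontinuous equimodular comparison** (HARD; the research content of the line).
For every `ε > 0` and every modulus `η ∈ (0,1)` there is `θ > 0` such that any two conformal
rectangles `R`, `R'` whose frontiers are covered by finitely many edges of `hℤ²` resp. `h'ℤ²`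
(marks anywhere) and whose conformal moduli are both `θ`-close to `η` have `P_{1/2}` bond-`ℤ²`
crossing probabilities at the dyadic meshes `h/2^k`, `h'/2^k` that differ by less than `ε` for all
large `k`.  No limit object, no existence, no value.  Implied by `CardyFormulaZ2` (continuity of
Cardy's `F`); implies the card's exact EQ (`η := η_R = η_{R'}`); contains dyadic ×2-consistency
(`R' = R`, `h' = h/2`). -/
protected theorem Holds.stub_equicontinuousComparison :
    ∀ ε : ℝ, 0 < ε → ∀ η ∈ Set.Ioo (0 : ℝ) 1, ∃ θ : ℝ, 0 < θ ∧
      ∀ h h' : ℝ, 0 < h → 0 < h' → ∀ R R' : ConformalRectangle,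
        (∃ S : Finset (ℂ × ℂ), (∀ p ∈ S, ∃ u v : Site 2, (zdGraph 2).Adj u v ∧
            p.1 = meshPoint h u ∧ p.2 = meshPoint h v) ∧
            frontier R.carrier ⊆ ⋃ p ∈ S, segment ℝ p.1 p.2) →
        (∃ S : Finset (ℂ × ℂ), (∀ p ∈ S, ∃ u v : Site 2, (zdGraph 2).Adj u v ∧
            p.1 = meshPoint h' u ∧ p.2 = meshPoint h' v) ∧
            frontier R'.carrier ⊆ ⋃ p ∈ S, segment ℝ p.1 p.2) →
        ∀ (φ : ConformalEquiv upperHalfPlaneSet R.carrier) (x : Fin 4 → ℝ)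
          (φ' : ConformalEquiv upperHalfPlaneSet R'.carrier) (x' : Fin 4 → ℝ),
          R.IsUniformizing φ x → R'.IsUniformizing φ' x' →
          |crossRatio x - η| < θ → |crossRatio x' - η| < θ →
          ∀ᶠ k : ℕ in atTop,
            |bondDomainCrossingProb R (h / 2 ^ k) - bondDomainCrossingProb R' (h' / 2 ^ k)| < ε := by
  sorry

/-- By-name handle of the registered stub `Holds.stub_equicontinuousComparison` (D-0027 §3.3 device). -/
def stub_equicontinuousComparison : Prop := type_of% Holds.stub_equicontinuousComparison

/-- STUB S2 — **the subsequential Bollobás–Riordan sandwich** (sequential form of the landed glue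
`DyadicLattice.hasCrossingLimit_of_dyadicLattice`).  If along a strictly increasing `κ : ℕ → ℕ`
every lattice polygon `P` of every mesh `h` has crossing probabilities converging along the shifted
ladders `h 2^j / 2^(κ n)` (`j : ℕ`) to `f(η_P)`, with `f` continuous on `(0,1)`, then EVERY
conformal rectangle `R` satisfies, along the meshes `1/2^(κ n)`, the lower bound
`f(η_R) - e < P[R]` and the upper bound `P[R] < 1 - f(1 - η_R) + e` eventually, for every `e > 0`
(lower comparison quad + lattice-polygon approximant + near-trivial dilates + exact dilation
covariance; upper bound by bond self-duality for the cyclically re-marked copy of modulus `1 - η_R`).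
Bollobás–Riordan 2006, Ch. 7 Claims 19–20 and remark p. 195. -/
protected theorem Holds.stub_subseqSandwich :
    ∀ (κ : ℕ → ℕ) (f : ℝ → ℝ), StrictMono κ → ContinuousOn f (Set.Ioo 0 1) →
      (∀ h : ℝ, 0 < h → ∀ P : ConformalRectangle,
        (∃ S : Finset (ℂ × ℂ), (∀ p ∈ S, ∃ u v : Site 2, (zdGraph 2).Adj u v ∧
            p.1 = meshPoint h u ∧ p.2 = meshPoint h v) ∧
            frontier P.carrier ⊆ ⋃ p ∈ S, segment ℝ p.1 p.2) →
        ∀ (ψ : ConformalEquiv upperHalfPlaneSet P.carrier) (y : Fin 4 → ℝ), P.IsUniformizing ψ y →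
          ∀ j : ℕ, Tendsto (fun n : ℕ => bondDomainCrossingProb P (h * 2 ^ j / 2 ^ (κ n))) atTop
            (𝓝 (f (crossRatio y)))) →
      ∀ (R : ConformalRectangle) (φ : ConformalEquiv upperHalfPlaneSet R.carrier) (x : Fin 4 → ℝ),
        R.IsUniformizing φ x → ∀ e : ℝ, 0 < e →
          (∀ᶠ n : ℕ in atTop, f (crossRatio x) - e < bondDomainCrossingProb R (1 / 2 ^ (κ n))) ∧
          (∀ᶠ n : ℕ in atTop,
            bondDomainCrossingProb R (1 / 2 ^ (κ n)) < 1 - f (1 - crossRatio x) + e) := by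
  -- LANDED p166738 (worker, Theorems/DyadicBetaRigidityDyadicLatticeBetaLawStubSubseqSandwich.lean)
  exact Stubs.stub_subseqSandwich

/-- By-name handle of the registered stub `Holds.stub_subseqSandwich` (D-0027 §3.3 device). -/
def stub_subseqSandwich : Prop := type_of% Holds.stub_subseqSandwich

/-- STUB S5a — **subsequential limits of the corner-marked boxes** (pure percolation).  For the
left–right family `Q w` and the bottom–top family `Q' w` of boxes `(0,w) × (0,1)` (specified by
carrier and arcs `0, 2`, as in the landed `stub_rectangleFamily`), every strictly increasing `κ`
has a sub-subsequence `κ ∘ σ` along whose meshes `1/2^(κ (σ n))` the crossing probabilities of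
`Q w` and `Q' w` converge for EVERY real `w > 0`, to `g w` resp. `g' w`, with `g`, `g'` continuous on
`(0, ∞)` and `g w + g' w = 1` (diagonal extraction over rational widths; mesh-uniform equicontinuity
in the width `crossingProb_uniformIncrement`; exact identification with lattice box crossings
`RectangleDuality.bond_lr_eq`, `bond_bt_le`, `le_bond_bt`; exact duality
`crossingProb_add_crossingProb_symm_holds`).  Schramm–Smirnov 2011 Lemma 6.1; Bollobás–Riordan
2006 Ch. 3 Lemma 1 and Ch. 7 §7.1. -/
protected theorem Holds.stub_rectSubseqLimits :
    ∀ (Q Q' : ℝ → ConformalRectangle),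
      (∀ w : ℝ, 0 < w → (Q w).carrier = (Set.Ioo (0 : ℝ) w ×ℂ Set.Ioo (0 : ℝ) 1) ∧
        (Q w).arc 0 = {z : ℂ | z.re = 0 ∧ z.im ∈ Set.Icc (0 : ℝ) 1} ∧
        (Q w).arc 2 = {z : ℂ | z.re = w ∧ z.im ∈ Set.Icc (0 : ℝ) 1}) →
      (∀ w : ℝ, 0 < w → (Q' w).carrier = (Set.Ioo (0 : ℝ) w ×ℂ Set.Ioo (0 : ℝ) 1) ∧
        (Q' w).arc 0 = {z : ℂ | z.im = 0 ∧ z.re ∈ Set.Icc (0 : ℝ) w} ∧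
        (Q' w).arc 2 = {z : ℂ | z.im = 1 ∧ z.re ∈ Set.Icc (0 : ℝ) w}) →
      ∀ κ : ℕ → ℕ, StrictMono κ → ∃ σ : ℕ → ℕ, StrictMono σ ∧ ∃ g g' : ℝ → ℝ,
        ContinuousOn g (Set.Ioi 0) ∧ ContinuousOn g' (Set.Ioi 0) ∧
        (∀ w : ℝ, 0 < w → g w + g' w = 1) ∧
        ∀ w : ℝ, 0 < w →
          Tendsto (fun n : ℕ => bondDomainCrossingProb (Q w) (1 / 2 ^ (κ (σ n)))) atTop (𝓝 (g w)) ∧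
          Tendsto (fun n : ℕ => bondDomainCrossingProb (Q' w) (1 / 2 ^ (κ (σ n)))) atTop
            (𝓝 (g' w)) := by
  -- LANDED p168483 (+ p167690) (worker, Theorems/DyadicBetaRigidityDyadicLatticeBetaLawStubRectSubseqLimits{,Boxes}.lean)
  exact Stubs.stub_rectSubseqLimits

/-- By-name handle of the registered stub `Holds.stub_rectSubseqLimits` (D-0027 §3.3 device). -/
def stub_rectSubseqLimits : Prop := type_of% Holds.stub_rectSubseqLimits

/-- STUB S5b — **the cluster law from comparison** (bookkeeping).  Assume S1 (equicontinuous
comparison) and S5a (box limits).  Let `R₀` be a lattice polygon of `h₀ℤ²` with uniformizing datum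
`(φ₀, x₀)` and let `p` be the limit of its crossing probabilities along `h₀/2^(κ n)` for a strictly
increasing `κ`.  Then along a sub-subsequence `κ ∘ σ` there is a law `f`, continuous on `(0,1)` with
`f(1-η) = 1 - f(η)` there and `f(η_{R₀}) = p`, such that EVERY lattice polygon `P` of every mesh `h`
converges along every shifted ladder `h 2^j / 2^(κ (σ n))` to `f(η_P)`.  (`σ, g, g'` from S5a for the
landed families `stub_rectangleFamily`; `f := g ∘ w(·)` with `w(t)` a width of modulus `t`
(`rectangle_crossRatio_eq_of_aspectRatio_holds` / `RectangleFamily.surj`); transfer from dyadic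
boxes to arbitrary lattice polygons, shift-invariance and well-definedness by S1; symmetry from
`g + g' = 1` and the bottom–top boxes of modulus `1 - η(w)`; `f(η_{R₀}) = p` by uniqueness of limits.) -/
protected theorem Holds.stub_clusterLawOfComparison :
    (∀ ε : ℝ, 0 < ε → ∀ η ∈ Set.Ioo (0 : ℝ) 1, ∃ θ : ℝ, 0 < θ ∧
      ∀ h h' : ℝ, 0 < h → 0 < h' → ∀ R R' : ConformalRectangle,
        (∃ S : Finset (ℂ × ℂ), (∀ p ∈ S, ∃ u v : Site 2, (zdGraph 2).Adj u v ∧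
            p.1 = meshPoint h u ∧ p.2 = meshPoint h v) ∧
            frontier R.carrier ⊆ ⋃ p ∈ S, segment ℝ p.1 p.2) →
        (∃ S : Finset (ℂ × ℂ), (∀ p ∈ S, ∃ u v : Site 2, (zdGraph 2).Adj u v ∧
            p.1 = meshPoint h' u ∧ p.2 = meshPoint h' v) ∧
            frontier R'.carrier ⊆ ⋃ p ∈ S, segment ℝ p.1 p.2) →
        ∀ (φ : ConformalEquiv upperHalfPlaneSet R.carrier) (x : Fin 4 → ℝ)
          (φ' : ConformalEquiv upperHalfPlaneSet R'.carrier) (x' : Fin 4 → ℝ),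
          R.IsUniformizing φ x → R'.IsUniformizing φ' x' →
          |crossRatio x - η| < θ → |crossRatio x' - η| < θ →
          ∀ᶠ k : ℕ in atTop,
            |bondDomainCrossingProb R (h / 2 ^ k) - bondDomainCrossingProb R' (h' / 2 ^ k)| < ε) →
    (∀ (Q Q' : ℝ → ConformalRectangle),
      (∀ w : ℝ, 0 < w → (Q w).carrier = (Set.Ioo (0 : ℝ) w ×ℂ Set.Ioo (0 : ℝ) 1) ∧
        (Q w).arc 0 = {z : ℂ | z.re = 0 ∧ z.im ∈ Set.Icc (0 : ℝ) 1} ∧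
        (Q w).arc 2 = {z : ℂ | z.re = w ∧ z.im ∈ Set.Icc (0 : ℝ) 1}) →
      (∀ w : ℝ, 0 < w → (Q' w).carrier = (Set.Ioo (0 : ℝ) w ×ℂ Set.Ioo (0 : ℝ) 1) ∧
        (Q' w).arc 0 = {z : ℂ | z.im = 0 ∧ z.re ∈ Set.Icc (0 : ℝ) w} ∧
        (Q' w).arc 2 = {z : ℂ | z.im = 1 ∧ z.re ∈ Set.Icc (0 : ℝ) w}) →
      ∀ κ : ℕ → ℕ, StrictMono κ → ∃ σ : ℕ → ℕ, StrictMono σ ∧ ∃ g g' : ℝ → ℝ,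
        ContinuousOn g (Set.Ioi 0) ∧ ContinuousOn g' (Set.Ioi 0) ∧
        (∀ w : ℝ, 0 < w → g w + g' w = 1) ∧
        ∀ w : ℝ, 0 < w →
          Tendsto (fun n : ℕ => bondDomainCrossingProb (Q w) (1 / 2 ^ (κ (σ n)))) atTop (𝓝 (g w)) ∧
          Tendsto (fun n : ℕ => bondDomainCrossingProb (Q' w) (1 / 2 ^ (κ (σ n)))) atTop
            (𝓝 (g' w))) →
    ∀ h₀ : ℝ, 0 < h₀ → ∀ R₀ : ConformalRectangle,
      (∃ S : Finset (ℂ × ℂ), (∀ p ∈ S, ∃ u v : Site 2, (zdGraph 2).Adj u v ∧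
          p.1 = meshPoint h₀ u ∧ p.2 = meshPoint h₀ v) ∧
          frontier R₀.carrier ⊆ ⋃ p ∈ S, segment ℝ p.1 p.2) →
      ∀ (φ₀ : ConformalEquiv upperHalfPlaneSet R₀.carrier) (x₀ : Fin 4 → ℝ), R₀.IsUniformizing φ₀ x₀ →
        ∀ κ : ℕ → ℕ, StrictMono κ → ∀ p : ℝ,
          Tendsto (fun n : ℕ => bondDomainCrossingProb R₀ (h₀ / 2 ^ (κ n))) atTop (𝓝 p) →
          ∃ σ : ℕ → ℕ, StrictMono σ ∧ ∃ f : ℝ → ℝ, ContinuousOn f (Set.Ioo 0 1) ∧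
            (∀ η ∈ Set.Ioo (0 : ℝ) 1, f (1 - η) = 1 - f η) ∧ f (crossRatio x₀) = p ∧
            ∀ h : ℝ, 0 < h → ∀ P : ConformalRectangle,
              (∃ S : Finset (ℂ × ℂ), (∀ p ∈ S, ∃ u v : Site 2, (zdGraph 2).Adj u v ∧
                  p.1 = meshPoint h u ∧ p.2 = meshPoint h v) ∧
                  frontier P.carrier ⊆ ⋃ p ∈ S, segment ℝ p.1 p.2) →
              ∀ (ψ : ConformalEquiv upperHalfPlaneSet P.carrier) (y : Fin 4 → ℝ),
                P.IsUniformizing ψ y →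
                ∀ j : ℕ, Tendsto (fun n : ℕ => bondDomainCrossingProb P (h * 2 ^ j / 2 ^ (κ (σ n))))
                  atTop (𝓝 (f (crossRatio y))) := by
  -- LANDED p169175 (+ p169117) (worker, Theorems/DyadicBetaRigidityDyadicLatticeBetaLawStubClusterLaw{Prelims,}.lean)
  exact Stubs.stub_clusterLawOfComparison

/-- By-name handle of the registered stub `Holds.stub_clusterLawOfComparison` (D-0027 §3.3 device). -/
def stub_clusterLawOfComparison : Prop := type_of% Holds.stub_clusterLawOfComparison

/-- STUB S3 — **sequential Cardy rigidity on `ℤ²`**: VERBATIM the item `CardyRigiditySeq` of route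
CardyExpCovariance (stmt-CriticalPhenomena-4680, shared; see `stub_cardyRigiditySeq_iff`).  If along
SOME sequence of meshes `u_k → 0⁺` the bond-`ℤ²` crossing probabilities of every conformal rectangle
converge to `f(cross-ratio)`, then `f = cardyFunction` on `(0,1)` (exploration path ⇒ SLE_κ along
`u_k`, locality ⇒ κ = 6, SLE₆ ⇒ Cardy).  It closes when that item closes; the lead of THIS crux does
not work on it. -/
protected theorem Holds.stub_cardyRigiditySeq :
    ∀ (u : ℕ → ℝ) (f : ℝ → ℝ), Tendsto u atTop (𝓝[>] (0 : ℝ)) →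
      (∀ (R : ConformalRectangle) (φ : ConformalEquiv upperHalfPlaneSet R.carrier) (x : Fin 4 → ℝ),
        R.IsUniformizing φ x →
          Tendsto (fun k => bondDomainCrossingProb R (u k)) atTop (𝓝 (f (crossRatio x)))) →
      Set.EqOn f cardyFunction (Set.Ioo 0 1) := by
  sorry

/-- By-name handle of the registered stub `Holds.stub_cardyRigiditySeq` (D-0027 §3.3 device). -/
def stub_cardyRigiditySeq : Prop := type_of% Holds.stub_cardyRigiditySeq

/-- STUB S3 is, definitionally, the route item `CardyExpCovariance.CardyRigiditySeq`
(stmt-CriticalPhenomena-4680). -/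
theorem stub_cardyRigiditySeq_iff :
    stub_cardyRigiditySeq ↔
      Summit.CriticalPhenomena.CardyFormulaZ2.Theses.CardyExpCovariance.CardyRigiditySeq :=
  Iff.rfl

/-! ### Glue lemmas (proved) -/

/-- **Cardy's function is the beta law of exponent `2/3`** on `(0,1)` (tree theorem
`cardyFunction_eq_incBeta13_div_holds`, Cardy 1992 eq. (8) integrated). -/
theorem cardyFunction_eq_betaLaw {η : ℝ} (hη : η ∈ Set.Ioo (0 : ℝ) 1) :
    cardyFunction η =
      (∫ s in (0 : ℝ)..η, (s * (1 - s)) ^ (-(2 / 3 : ℝ))) /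
        ∫ s in (0 : ℝ)..1, (s * (1 - s)) ^ (-(2 / 3 : ℝ)) :=
  cardyFunction_eq_incBeta13_div_holds η ⟨hη.1.le, hη.2.le⟩

/-- The meshes `1/2^(m n)` of a strictly increasing `m : ℕ → ℕ` tend to `0` from the right. -/
theorem tendsto_mesh_of_strictMono {m : ℕ → ℕ} (hm : StrictMono m) :
    Tendsto (fun n : ℕ => (1 : ℝ) / 2 ^ (m n)) atTop (𝓝[>] (0 : ℝ)) := by
  rw [tendsto_nhdsWithin_iff]
  refine ⟨?_, Eventually.of_forall fun n => Set.mem_Ioi.2 (by positivity)⟩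
  have h1 : Tendsto (fun n : ℕ => (2 : ℝ) ^ (m n)) atTop atTop :=
    (tendsto_pow_atTop_atTop_of_one_lt one_lt_two).comp hm.tendsto_atTop
  exact tendsto_const_nhds.div_atTop h1

/-- From the two one-sided sandwich bounds and the symmetry of the law: convergence. -/
theorem tendsto_of_sandwich {P : ℕ → ℝ} {L L' : ℝ} (hLL' : L' = L)
    (h : ∀ e : ℝ, 0 < e → (∀ᶠ n : ℕ in atTop, L - e < P n) ∧ (∀ᶠ n : ℕ in atTop, P n < L' + e)) :
    Tendsto P atTop (𝓝 L) := by
  subst hLL'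
  rw [Metric.tendsto_nhds]
  intro e he
  obtain ⟨h1, h2⟩ := h e he
  filter_upwards [h1, h2] with n hn1 hn2
  rw [Real.dist_eq, abs_sub_lt_iff]
  constructor <;> linarith

/-- **Composition** (kernel-checked, no `sorry`): STUBS S1, S2, S5a, S5b, S3 imply the crux
`DyadicLatticeBetaLaw` of route `DyadicBetaRigidity` (stmt-CriticalPhenomena-18183), with `a := 2/3`.
Every subsequence `ns` of the dyadic ladder of a lattice polygon `R` has a strictly increasing,
convergent refinement `κ` (compactness of `[0,1]`); S5b (fed by S1, S5a) passes a continuous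
self-dual law `f` with `f(η_R) = lim` through it; S2 upgrades to convergence of every conformal
rectangle along `1/2^(κ (σ n))`; S3 identifies `f = cardyFunction = I_{2/3}` on `(0,1)`; hence every
cluster point is `I_{2/3}(η_R)` and the ladder converges (`tendsto_of_subseq_tendsto`). -/
theorem DyadicLatticeBetaLaw_of :
    stub_equicontinuousComparison → stub_subseqSandwich → stub_rectSubseqLimits →
      stub_clusterLawOfComparison → stub_cardyRigiditySeq →
      Summit.CriticalPhenomena.CardyFormulaZ2.Theses.DyadicBetaRigidity.DyadicLatticeBetaLaw := by
  intro hEQ hSW hRL hCL hRig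
  dsimp only [stub_equicontinuousComparison, stub_subseqSandwich, stub_rectSubseqLimits,
    stub_clusterLawOfComparison, stub_cardyRigiditySeq] at hEQ hSW hRL hCL hRig
  refine ⟨2 / 3, ⟨by norm_num, by norm_num⟩, ?_⟩
  intro h hh R hR φ x hφ
  have hη : crossRatio x ∈ Set.Ioo (0 : ℝ) 1 :=
    ConformalRectangle.crossRatio_mem_Ioo_of_isUniformizing hφ
  rw [← cardyFunction_eq_betaLaw hη]
  refine tendsto_of_subseq_tendsto fun ns hns => ?_
  -- a strictly increasing refinement of `ns`
  obtain ⟨ψ, -, hnsψ⟩ := strictMono_subseq_of_tendsto_atTop hns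
  -- a convergent further subsequence (compactness of `[0,1]`)
  obtain ⟨p, -, ψ', hψ', hp⟩ := isCompact_Icc.tendsto_subseq
    (x := fun n => bondDomainCrossingProb R (h / 2 ^ (ns (ψ n))))
    (fun n => bondDomainCrossingProb_mem_Icc R _)
  set κ : ℕ → ℕ := fun n => ns (ψ (ψ' n)) with hκ
  have hκm : StrictMono κ := hnsψ.comp hψ'
  have hpκ : Tendsto (fun n => bondDomainCrossingProb R (h / 2 ^ (κ n))) atTop (𝓝 p) := hp
  -- S5b (with S1, S5a): a continuous self-dual law `f` through the cluster point `p`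
  obtain ⟨σ, hσ, f, hfc, hfs, hfp, hlaw⟩ := hCL hEQ hRL h hh R hR φ x hφ κ hκm p hpκ
  have hκσ : StrictMono fun n => κ (σ n) := hκm.comp hσ
  -- S2: every conformal rectangle converges along `1/2^(κ (σ n))` to `f`
  have hall : ∀ (R' : ConformalRectangle) (φ' : ConformalEquiv upperHalfPlaneSet R'.carrier)
      (x' : Fin 4 → ℝ), R'.IsUniformizing φ' x' →
      Tendsto (fun n => bondDomainCrossingProb R' (1 / 2 ^ (κ (σ n)))) atTop
        (𝓝 (f (crossRatio x'))) := by
    intro R' φ' x' hφ'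
    have hη' := ConformalRectangle.crossRatio_mem_Ioo_of_isUniformizing hφ'
    have hsymm : 1 - f (1 - crossRatio x') = f (crossRatio x') := by
      rw [hfs _ hη']; ring
    exact tendsto_of_sandwich hsymm (hSW (fun n => κ (σ n)) f hκσ hfc hlaw R' φ' x' hφ')
  -- S3: rigidity identifies `f` with Cardy's function on `(0,1)`
  have hEqOn : Set.EqOn f cardyFunction (Set.Ioo 0 1) :=
    hRig (fun n => 1 / 2 ^ (κ (σ n))) f (tendsto_mesh_of_strictMono hκσ) hall
  -- hence the cluster point is `F(η)` and the refinement `ψ ∘ ψ' ∘ σ` of `ns` converges to it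
  refine ⟨fun n => ψ (ψ' (σ n)), ?_⟩
  have hlim : Tendsto (fun n => bondDomainCrossingProb R (h / 2 ^ (κ (σ n)))) atTop (𝓝 p) :=
    hpκ.comp hσ.tendsto_atTop
  rw [← hfp, hEqOn hη] at hlim
  exact hlim

/-- **The crux reduced to S1 and sequential rigidity** (everything else landed): equicontinuous
equimodular comparison plus `CardyExpCovariance.CardyRigiditySeq` (stmt-CriticalPhenomena-4680)
imply `DyadicLatticeBetaLaw`. No `sorry` in the cone of this theorem besides its two hypotheses. -/
theorem DyadicLatticeBetaLaw_of_S1_of_rigiditySeq (hS1 : stub_equicontinuousComparison)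
    (hRig : Summit.CriticalPhenomena.CardyFormulaZ2.Theses.CardyExpCovariance.CardyRigiditySeq) :
    Summit.CriticalPhenomena.CardyFormulaZ2.Theses.DyadicBetaRigidity.DyadicLatticeBetaLaw :=
  DyadicLatticeBetaLaw_of hS1 Stubs.stub_subseqSandwich Stubs.stub_rectSubseqLimits
    Stubs.stub_clusterLawOfComparison (stub_cardyRigiditySeq_iff.2 hRig)

/-- **The line is tight**: modulo the external sequential rigidity item (stmt-CriticalPhenomena-4680)
the crux is EQUIVALENT to the hard stub S1 (`→`: support stub `stub_equicontinuousComparison_of_crux`,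
p169502, uniform continuity of `I_a`; `←`: the composition with the landed S2/S5a/S5b). -/
theorem dyadicLatticeBetaLaw_iff_S1
    (hRig : Summit.CriticalPhenomena.CardyFormulaZ2.Theses.CardyExpCovariance.CardyRigiditySeq) :
    Summit.CriticalPhenomena.CardyFormulaZ2.Theses.DyadicBetaRigidity.DyadicLatticeBetaLaw ↔
      stub_equicontinuousComparison :=
  ⟨fun h => Stubs.stub_equicontinuousComparison_of_crux h,
    fun h => DyadicLatticeBetaLaw_of_S1_of_rigiditySeq h hRig⟩

/-- The composition applied to the five registered stubs: the crux, conditionally on the stubs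
(the only `sorry`s of this file are inside `stub_*`). -/
theorem dyadicLatticeBetaLaw_of_stubs :
    Summit.CriticalPhenomena.CardyFormulaZ2.Theses.DyadicBetaRigidity.DyadicLatticeBetaLaw :=
  DyadicLatticeBetaLaw_of Holds.stub_equicontinuousComparison Holds.stub_subseqSandwich
    Holds.stub_rectSubseqLimits Holds.stub_clusterLawOfComparison Holds.stub_cardyRigiditySeq

end Summit.CriticalPhenomena.CardyFormulaZ2.Cruxes.DyadicLatticeBetaLaw.EquimodularComparison

end
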